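import Summits.Ventures.HodgeRepro2.T5InertSatakeCounts

/-!
# The cosets `n a_m K` at an inert place: `K ∩ N = N(R)`, the uniqueness of `m`, and the count of `K a₁ K ∩ N a_m K`
(cell pub-hodge-repro2, seat p3)

Tier-5 N3 support, towards the one sentence of the Satake chain still in print after files 209–214: the
identification of the Hecke eigenvalue of the spherical vector of the unramified principal series with
`S(T₁)` at the Satake parameter. That computation sums `f₀` over `K a₁ K / K`, grouping the cosets `xK` by the
`m` with `x ∈ N a_m K` (the Iwasawa decomposition). This file supplies the coset bookkeeping:

* **`mem_hyperspecial_iff_mem_unipCong`** — `K ∩ N = N(R)`: a unipotent `n(x, z)` is integral iff `x, z ∈ R`;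
* **`upperUnipotent_mul_cellZ_mem_hyperspecial_iff`** — `n a_j ∈ K ⟺ j = 0 ∧ n ∈ N(R)`;
* **`eq_of_mul_cellZ_mul_eq`** — `n a_m k = n' a_{m'} k'` forces `m = m'` (the pieces `N a_m K` are disjoint);
* **`ncard_orbit_inter_eq_satakeCount`** — `#{xK ⊆ K a₁ K : x ∈ N a_m K} = satakeCount 1 m` (the bijection
  `n a_m K ↦ (a_m⁻¹ n a_m) N(R)`).

Mathlib + this seat's file 212 and its imports; no display; no device.
§8(d): uses an L-value-free non-vanishing device: NO.
-/

namespace Summit.Ventures.HodgeRepro2.T5InertIwasawaCosets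

open Summit.Ventures.HodgeRepro2.T5CartanCellsDistinct Summit.Ventures.HodgeRepro2.T5HeckeBasisCells
  Summit.Ventures.HodgeRepro2.T5HermitianThreeElements Summit.Ventures.HodgeRepro2.T5UnitaryGroupForm
  Summit.Ventures.HodgeRepro2.T5UnitaryHeckeAdjoint Summit.Ventures.HodgeRepro2.T5InertUnipotentCongruence
  Summit.Ventures.HodgeRepro2.T5InertCartanInvariant Summit.Ventures.HodgeRepro2.T5InertUnipotentRadical
  Summit.Ventures.HodgeRepro2.T5InertSatakeSets Summit.Ventures.HodgeRepro2.T5InertSatakeCounts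
  Summit.Ventures.HodgeRepro2.T5InertDegreePrinted

section Cells

variable {R E : Type*} [CommRing R] [Field E] [StarRing E] [Algebra R E] [IsFractionRing R E]
  (u : E) {ϖ : R} (hϖ : Irreducible ϖ) (hs : star (algebraMap R E ϖ) = algebraMap R E ϖ)

/-- `a₀ = 1`. -/
theorem cellZ_zero : cellZ u hϖ hs 0 = 1 := by
  rw [show (0 : ℤ) = ((0 : ℕ) : ℤ) from rfl, cellZ_natCast, cellU_zero u hϖ hs]

include hϖ in
/-- `a_m a_{m'} = a_{m+m'}`. -/
theorem cellZ_mul (m m' : ℤ) : cellZ u hϖ hs m * cellZ u hϖ hs m' = cellZ u hϖ hs (m + m') := by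
  have hϖ0 : algebraMap R E ϖ ≠ 0 := (map_ne_zero_iff _ (IsFractionRing.injective R E)).2 hϖ.ne_zero
  apply Subtype.ext
  apply Units.ext
  rw [Subgroup.coe_mul, Units.val_mul, coe_cellZ, coe_cellZ, coe_cellZ, Matrix.mul_fin_three, fin_three_eq_iff]
  refine ⟨?_, by ring, by ring, by ring, by ring, by ring, by ring, by ring, ?_⟩
  · rw [zpow_add₀ hϖ0]; ring
  · rw [neg_add, zpow_add₀ hϖ0]; ring

include hϖ in
/-- Conjugation by a cell preserves `N`. -/
theorem conj_cellZ_mem_upperUnipotent (j : ℤ) {n : formUnitaryGroup (J3 u)} (hn : n ∈ upperUnipotent u) :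
    cellZ u hϖ hs j * n * (cellZ u hϖ hs j)⁻¹ ∈ upperUnipotent u := by
  obtain ⟨x, z, hn⟩ := hn
  exact ⟨_, _, by rw [Subgroup.coe_mul, Subgroup.coe_mul, Subgroup.coe_inv, hn, cellZ_mul_upper3_mul_cellZ_inv]⟩

end Cells

section Integral

variable {R E : Type*} [CommRing R] [IsDomain R] [IsDiscreteValuationRing R] [Field E] [StarRing E]
  [Algebra R E] [IsFractionRing R E] [Finite (IsLocalRing.ResidueField R)]
  (hstar : ∀ x : E, IsLocalization.IsInteger R x → IsLocalization.IsInteger R (star x))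
  (u : E) (hsu : star u = u) (hu0 : u ≠ 0) (hu : IsLocalization.IsInteger R u)
  (hu' : IsLocalization.IsInteger R u⁻¹) {ϖ : R} (hϖ : Irreducible ϖ)
  (hs : star (algebraMap R E ϖ) = algebraMap R E ϖ)

include hstar hsu hu0 hu hu' in
/-- **`a_j n ∈ K ⟺ j = 0 ∧ n ∈ N(R)`** for `n = n(x, z)`: `ϖ^j`, `ϖ^{−j}`, `ϖ^j x`, `ϖ^j z`, `x̄/u` must be integral. -/
theorem cellZ_mul_mem_hyperspecial_iff {n : formUnitaryGroup (J3 u)} {x z : E}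
    (hn : (n : GL (Fin 3) E) = upper3 u x z) (j : ℤ) :
    cellZ u hϖ hs j * n ∈ hyperspecialSubgroup R (J3 u) ↔ j = 0 ∧ n ∈ unipCong hstar u hu' hs 0 0 le_rfl := by
  rw [← mem_orbit_cellU_zero_iff_mem u hϖ hs, mem_orbit_cellU_zero_iff hstar u hsu hu0 hu hu' hϖ hs,
    Subgroup.coe_mul, Units.val_mul, hn, Nat.cast_zero, clears_cellZ_mul_upper3_iff u hϖ hs,
    mem_unipCong_iff_isInteger hstar u hu' hϖ hs hn]
  constructor
  · rintro ⟨h1, h2, hx, hz, -⟩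
    have hj : j = 0 := by omega
    subst hj
    exact ⟨rfl, by simpa using hx, by simpa using hz⟩
  · rintro ⟨rfl, hx, hz⟩
    simp only [Nat.cast_zero, neg_zero, zpow_zero, one_mul] at hx hz
    refine ⟨by omega, by omega, by simpa using hx, by simpa using hz, ?_⟩
    rw [zpow_zero, one_mul, div_eq_mul_inv]
    exact IsLocalization.isInteger_mul (hstar _ hx) hu'

include hstar hsu hu0 hu hu' hϖ in
/-- **`K ∩ N = N(R)`**: a unipotent element is integral iff it lies in `N(R)`. -/
theorem mem_hyperspecial_iff_mem_unipCong {n : formUnitaryGroup (J3 u)} (hn : n ∈ upperUnipotent u) :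
    n ∈ hyperspecialSubgroup R (J3 u) ↔ n ∈ unipCong hstar u hu' hs 0 0 le_rfl := by
  obtain ⟨x, z, hn⟩ := hn
  have h := cellZ_mul_mem_hyperspecial_iff hstar u hsu hu0 hu hu' hϖ hs hn 0
  rw [cellZ_zero, one_mul] at h
  simpa using h

include hstar hsu hu0 hu hu' in
/-- **`n a_j ∈ K ⟺ j = 0 ∧ n ∈ N(R)`** (the cell on the right). -/
theorem upperUnipotent_mul_cellZ_mem_hyperspecial_iff {n : formUnitaryGroup (J3 u)} (hn : n ∈ upperUnipotent u)
    (j : ℤ) :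
    n * cellZ u hϖ hs j ∈ hyperspecialSubgroup R (J3 u) ↔ j = 0 ∧ n ∈ unipCong hstar u hu' hs 0 0 le_rfl := by
  obtain ⟨x, z, hn'⟩ := hn
  -- `n a_j = a_j (a_j⁻¹ n a_j)` with `a_j⁻¹ n a_j = n(ϖ^{−j} x, ϖ^{−2j} z)`
  have hconj : ((cellZ u hϖ hs (-j) * n * (cellZ u hϖ hs (-j))⁻¹ : formUnitaryGroup (J3 u)) : GL (Fin 3) E) =
      upper3 u (algebraMap R E ϖ ^ (-j) * x) (algebraMap R E ϖ ^ (2 * -j) * z) := by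
    rw [Subgroup.coe_mul, Subgroup.coe_mul, Subgroup.coe_inv, hn', cellZ_mul_upper3_mul_cellZ_inv]
  have hrew : n * cellZ u hϖ hs j = cellZ u hϖ hs j * (cellZ u hϖ hs (-j) * n * (cellZ u hϖ hs (-j))⁻¹) := by
    rw [cellZ_neg, inv_inv]
    group
  rw [hrew, cellZ_mul_mem_hyperspecial_iff hstar u hsu hu0 hu hu' hϖ hs hconj j]
  constructor
  · rintro ⟨rfl, h⟩
    rw [neg_zero, cellZ_zero, one_mul, inv_one, mul_one] at h
    exact ⟨rfl, h⟩
  · rintro ⟨rfl, h⟩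
    rw [neg_zero, cellZ_zero, one_mul, inv_one, mul_one]
    exact ⟨rfl, h⟩

include hstar hsu hu0 hu hu' in
/-- **The pieces `N a_m K` are disjoint**: `n a_m k = n' a_{m'} k'` forces `m = m'`. -/
theorem eq_of_mul_cellZ_mul_eq {n n' : formUnitaryGroup (J3 u)} (hn : n ∈ upperUnipotent u)
    (hn' : n' ∈ upperUnipotent u) {k k' : formUnitaryGroup (J3 u)} (hk : k ∈ hyperspecialSubgroup R (J3 u))
    (hk' : k' ∈ hyperspecialSubgroup R (J3 u)) {m m' : ℤ}
    (h : n * cellZ u hϖ hs m * k = n' * cellZ u hϖ hs m' * k') : m = m' := by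
  -- `a_m⁻¹ n⁻¹ n' a_{m'} = k k'⁻¹ ∈ K`
  have h2 : n' * cellZ u hϖ hs m' = n * cellZ u hϖ hs m * k * k'⁻¹ := by
    rw [h, mul_inv_cancel_right]
  have h3 : (cellZ u hϖ hs m)⁻¹ * (n⁻¹ * n') * cellZ u hϖ hs m' = k * k'⁻¹ := by
    rw [mul_assoc, mul_assoc, h2]
    group
  have hK : (cellZ u hϖ hs m)⁻¹ * (n⁻¹ * n') * cellZ u hϖ hs m' ∈ hyperspecialSubgroup R (J3 u) := by
    rw [h3]
    exact Subgroup.mul_mem _ hk (Subgroup.inv_mem _ hk')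
  -- rewrite it as `(a_{−m} (n⁻¹ n') a_{−m}⁻¹) · a_{m' − m}`
  have h4 : (cellZ u hϖ hs m)⁻¹ * (n⁻¹ * n') * cellZ u hϖ hs m' =
      (cellZ u hϖ hs (-m) * (n⁻¹ * n') * (cellZ u hϖ hs (-m))⁻¹) * cellZ u hϖ hs (m' - m) := by
    have hinv : (cellZ u hϖ hs (-m))⁻¹ = cellZ u hϖ hs m := by rw [cellZ_neg, inv_inv]
    rw [← cellZ_neg, hinv, mul_assoc _ (cellZ u hϖ hs m), cellZ_mul, show m + (m' - m) = m' by ring]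
  rw [h4, upperUnipotent_mul_cellZ_mem_hyperspecial_iff hstar u hsu hu0 hu hu' hϖ hs
    (conj_cellZ_mem_upperUnipotent u hϖ hs (-m) (Subgroup.mul_mem _ (Subgroup.inv_mem _ hn) hn'))] at hK
  omega

end Integral

section Count

variable {R E : Type*} [CommRing R] [IsDomain R] [IsDiscreteValuationRing R] [Field E] [StarRing E]
  [Algebra R E] [IsFractionRing R E] [Finite (IsLocalRing.ResidueField R)]
  (hstar : ∀ x : E, IsLocalization.IsInteger R x → IsLocalization.IsInteger R (star x))
  (u : E) (hsu : star u = u) (hu0 : u ≠ 0) (hu : IsLocalization.IsInteger R u)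
  (hu' : IsLocalization.IsInteger R u⁻¹) {ϖ : R} (hϖ : Irreducible ϖ)
  (hs : star (algebraMap R E ϖ) = algebraMap R E ϖ)

/-- **The piece of `K a₁ K / K` over `m`**: the cosets `xK ⊆ K a₁ K` with `x ∈ N a_m K`. -/
def iwasawaPiece (m : ℤ) : Set (formUnitaryGroup (J3 u) ⧸ hyperspecialSubgroup R (J3 u)) :=
  {x | x ∈ MulAction.orbit (hyperspecialSubgroup R (J3 u))
      ((cellU hϖ hs u 1 : formUnitaryGroup (J3 u)) : formUnitaryGroup (J3 u) ⧸ hyperspecialSubgroup R (J3 u)) ∧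
    ∃ n ∈ upperUnipotent u, x = ((n * cellZ u hϖ hs m : formUnitaryGroup (J3 u)) :
      formUnitaryGroup (J3 u) ⧸ hyperspecialSubgroup R (J3 u))}

omit [IsDomain R] [IsDiscreteValuationRing R] [Finite (IsLocalRing.ResidueField R)] in
include hϖ in
/-- The piece over `m` is the image of `{n ∈ N : a_m n ∈ K a₁ K}` under `n ↦ a_m n K`. -/
theorem iwasawaPiece_eq_image (m : ℤ) :
    iwasawaPiece (R := R) u hϖ hs m =
      (fun n : formUnitaryGroup (J3 u) => ((cellZ u hϖ hs m * n : formUnitaryGroup (J3 u)) :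
        formUnitaryGroup (J3 u) ⧸ hyperspecialSubgroup R (J3 u))) '' satakeSet (R := R) u hϖ hs 1 m := by
  ext x
  constructor
  · rintro ⟨hx, n', hn', rfl⟩
    refine ⟨(cellZ u hϖ hs m)⁻¹ * n' * cellZ u hϖ hs m, ⟨?_, ?_⟩, ?_⟩
    · have := conj_cellZ_mem_upperUnipotent u hϖ hs (-m) hn'
      rwa [cellZ_neg, inv_inv] at this
    · rwa [show cellZ u hϖ hs m * ((cellZ u hϖ hs m)⁻¹ * n' * cellZ u hϖ hs m) = n' * cellZ u hϖ hs m by group]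
    · show ((cellZ u hϖ hs m * ((cellZ u hϖ hs m)⁻¹ * n' * cellZ u hϖ hs m) : formUnitaryGroup (J3 u)) :
        formUnitaryGroup (J3 u) ⧸ hyperspecialSubgroup R (J3 u)) = _
      rw [show cellZ u hϖ hs m * ((cellZ u hϖ hs m)⁻¹ * n' * cellZ u hϖ hs m) = n' * cellZ u hϖ hs m by group]
  · rintro ⟨n, ⟨hn, hmem⟩, rfl⟩
    refine ⟨hmem, cellZ u hϖ hs m * n * (cellZ u hϖ hs m)⁻¹, conj_cellZ_mem_upperUnipotent u hϖ hs m hn, ?_⟩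
    show _ = ((cellZ u hϖ hs m * n * (cellZ u hϖ hs m)⁻¹ * cellZ u hϖ hs m : formUnitaryGroup (J3 u)) :
      formUnitaryGroup (J3 u) ⧸ hyperspecialSubgroup R (J3 u))
    rw [inv_mul_cancel_right]

include hstar hsu hu0 hu hu' in
/-- **`#{xK ⊆ K a₁ K : x ∈ N a_m K} = satakeCount 1 m`**: the bijection `n N(R) ↦ a_m n K`. -/
theorem ncard_iwasawaPiece_eq_satakeCount (m : ℤ) :
    (iwasawaPiece (R := R) u hϖ hs m).ncard = satakeCount hstar u hu' hϖ hs 1 m := by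
  rw [iwasawaPiece_eq_image, satakeCount]
  -- the map `G ⧸ N(R) → G ⧸ K`, `g N(R) ↦ a_m g K`
  let φ : formUnitaryGroup (J3 u) ⧸ unipCong hstar u hu' hs 0 0 le_rfl →
      formUnitaryGroup (J3 u) ⧸ hyperspecialSubgroup R (J3 u) :=
    Quotient.map' (fun g => cellZ u hϖ hs m * g) fun a b hab => by
      rw [QuotientGroup.leftRel_apply] at hab ⊢
      rw [mul_inv_rev, mul_assoc, inv_mul_cancel_left]
      exact (mem_hyperspecial_iff_mem_unipCong hstar u hsu hu0 hu hu' hϖ hs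
        (unipCong_le_upperUnipotent u hstar hu' hs hab)).2 hab
  have himg : (fun n : formUnitaryGroup (J3 u) => ((cellZ u hϖ hs m * n : formUnitaryGroup (J3 u)) :
      formUnitaryGroup (J3 u) ⧸ hyperspecialSubgroup R (J3 u))) '' satakeSet (R := R) u hϖ hs 1 m =
      φ '' ((QuotientGroup.mk : formUnitaryGroup (J3 u) →
        formUnitaryGroup (J3 u) ⧸ unipCong hstar u hu' hs 0 0 le_rfl) '' satakeSet (R := R) u hϖ hs 1 m) := by
    rw [Set.image_image]
    rfl
  rw [himg]
  apply Set.InjOn.ncard_image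
  rintro c ⟨n, hn, rfl⟩ c' ⟨n', hn', rfl⟩ hc
  change ((cellZ u hϖ hs m * n : formUnitaryGroup (J3 u)) : formUnitaryGroup (J3 u) ⧸ hyperspecialSubgroup R (J3 u)) =
    ((cellZ u hϖ hs m * n' : formUnitaryGroup (J3 u)) : formUnitaryGroup (J3 u) ⧸ hyperspecialSubgroup R (J3 u)) at hc
  rw [QuotientGroup.eq, mul_inv_rev, mul_assoc, inv_mul_cancel_left] at hc
  rw [QuotientGroup.eq]
  exact (mem_hyperspecial_iff_mem_unipCong hstar u hsu hu0 hu hu' hϖ hs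
    (Subgroup.mul_mem _ (Subgroup.inv_mem _ hn.1) hn'.1)).1 hc

end Count

end Summit.Ventures.HodgeRepro2.T5InertIwasawaCosets
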